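/-
Copyright: derived here (Resolution Observatory cell `pub-rosobs`, carver gen 56). AI-written Lean; AI review is weaker than expert
review.  Companion file of the cell's POLYNOMIAL weighted-centre model `W(f)`: the DOMAIN half of hypothesis (U) of engine 1's LEMMA FC
(THEOREM-FC-eng1-g37 §4 (B2)/(B5); CARVER-NOTES-eng1-g37 T48) — the Fermat-curve coordinate ring is a domain.
Instrument — NOT a resolution theorem and NOT a statement about the invariant of [AbramovichTemkinWlodarczyk2024].
-/
import Mathlib.RingTheory.Polynomial.Eisenstein.Basic
import Mathlib.RingTheory.Polynomial.UniqueFactorization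
import Mathlib.RingTheory.AdjoinRoot
import Mathlib.FieldTheory.Separable
import Mathlib.Algebra.Module.Torsion.Free
import HarnessLib

/-!
# The Fermat-curve coordinate ring `K[t][s] ⧸ (s^m + 1 + t^m)` is a domain (`(m : K) ≠ 0`)

Uniform value line: INSTRUMENT — kernel-checked commutative algebra for the polynomial weighted-centre model `W(f)` of the cell (engine 1's
toy model: THEOREM-FC-eng1-g37 §4, LEMMA FC; CARVER-NOTES-eng1-g37 T48) — NOT a resolution theorem, NOT a statement about the
Abramovich–Temkin–Włodarczyk invariant, NOT summit progress; AI-written Lean, AI review is weaker than expert review.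

What is here.  `K` a field, `m > 0` with `(m : K) ≠ 0` (the engine's `m` = prime-to-`p` part of the least pure exponent).  The polynomial
`s^m + (1 + t^m) ∈ K[t][s]` — written `X ^ m + C (1 + X ^ m) : K[X][X]`, which is `FermatComposition.fermat m` of the companion file
`WeightedCentreFermatComposition` by `FermatComposition.fermat_def` (that file is not imported here only because of build ordering) — is

* Eisenstein at any prime factor `π` of the separable polynomial `1 + t^m` (`separable_one_add_X_pow`, `exists_prime_factor`), hence
  IRREDUCIBLE (`irreducible_fermat`, [Lang2002, IV §3 Thm 3.1]) and PRIME in the UFD `K[t][s]` (`prime_fermat`);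
* so `B′ := AdjoinRoot (X ^ m + C (1 + X ^ m)) = K[t][s] ⧸ (s^m + 1 + t^m)` is a DOMAIN (`isDomain_adjoinRoot_fermat`), and every non-zero
  `u : B′` is `M`-regular on every torsion-free `B′`-module (`isSMulRegular_of_ne_zero`, `isSMulRegular_self_of_ne_zero`) — this is hypothesis
  (U) of LEMMA FC (B5) (`FermatComposition.map_eq_zero_of_orderComp_eq_zero`, argument `hu`) once `u_k = 1 + t^k + s^k ≠ 0` is known, which is
  `FermatComposition.mk_fermat_ne_zero` (`m ∤ k`); the dictionary `mk_fermat_eq_powerSum` identifies `u_k` with the power sum of `(1, t, s)`.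

NOT here: anything about the model (which module `M` the engine reads compositions in, and that it is torsion-free over `B′` — for a FREE
module, e.g. `B′ ⊗_K A` with `A` a `K`-vector space, this is automatic).

References: [Lang2002] IV §3 (Eisenstein's criterion; Mathlib `Polynomial.IsEisensteinAt.irreducible`); context [AbramovichTemkinWlodarczyk2024] §5.
-/

namespace Literature.AlgebraicGeometry.Resolution.WeightedBlowup

namespace FermatDomain

open Polynomial

variable {K : Type*} [Field K]

/-- `1 + t^m` is separable when `(m : K) ≠ 0` (it is `X^m − C(−1)`). [cite: Lang2002, IV §3 Thm 3.1] -/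
theorem separable_one_add_X_pow {m : ℕ} (hmK : (m : K) ≠ 0) : Separable (1 + X ^ m : K[X]) := by
  have h := separable_X_pow_sub_C (-1 : K) hmK (by norm_num)
  have e : (X ^ m - C (-1) : K[X]) = 1 + X ^ m := by
    rw [map_neg, map_one, sub_neg_eq_add, add_comm]
  rwa [e] at h

/-- `1 + t^m = X^m + C 1` (plumbing). [cite: Lang2002, IV §3 Thm 3.1] -/
theorem one_add_X_pow_eq (m : ℕ) : (1 + X ^ m : K[X]) = X ^ m + C 1 := by
  rw [map_one, add_comm]

/-- `1 + t^m` is not a unit for `m > 0` (it has degree `m`). [cite: Lang2002, IV §3 Thm 3.1] -/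
theorem not_isUnit_one_add_X_pow {m : ℕ} (hm : 0 < m) : ¬ IsUnit (1 + X ^ m : K[X]) := by
  intro h
  have hdeg := natDegree_eq_zero_of_isUnit h
  rw [one_add_X_pow_eq, natDegree_X_pow_add_C] at hdeg
  omega

/-- A prime factor `π` of `1 + t^m` with `π² ∤ 1 + t^m` exists (`m > 0`, `(m : K) ≠ 0`: separable ⇒ squarefree).
[cite: Lang2002, IV §3 Thm 3.1] -/
theorem exists_prime_factor {m : ℕ} (hm : 0 < m) (hmK : (m : K) ≠ 0) :
    ∃ π : K[X], Prime π ∧ π ∣ (1 + X ^ m) ∧ ¬ π ^ 2 ∣ (1 + X ^ m) := by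
  have hsep := separable_one_add_X_pow (K := K) hmK
  have hne : (1 + X ^ m : K[X]) ≠ 0 := hsep.ne_zero
  obtain ⟨π, hirr, hdvd⟩ := WfDvdMonoid.exists_irreducible_factor (not_isUnit_one_add_X_pow hm) hne
  refine ⟨π, hirr.prime, hdvd, fun h2 => hirr.not_isUnit ?_⟩
  exact hsep.squarefree π (by rwa [pow_two] at h2)

/-- **Eisenstein**: `s^m + (1 + t^m) ∈ K[t][s]` is irreducible for `m > 0`, `(m : K) ≠ 0` (Eisenstein at a simple prime factor of `1 + t^m`;
derived here from Mathlib's `Polynomial.IsEisensteinAt.irreducible`). [cite: Lang2002, IV §3 Thm 3.1] -/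
theorem irreducible_fermat {m : ℕ} (hm : 0 < m) (hmK : (m : K) ≠ 0) :
    Irreducible (X ^ m + C (1 + X ^ m) : K[X][X]) := by
  obtain ⟨π, hπ, hdvd, hndvd⟩ := exists_prime_factor (K := K) hm hmK
  have hmonic : (X ^ m + C (1 + X ^ m) : K[X][X]).Monic := monic_X_pow_add_C _ hm.ne'
  have hdeg : (X ^ m + C (1 + X ^ m) : K[X][X]).natDegree = m := natDegree_X_pow_add_C
  have hprime : (Ideal.span {π} : Ideal K[X]).IsPrime := (Ideal.span_singleton_prime hπ.ne_zero).mpr hπ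
  refine Polynomial.IsEisensteinAt.irreducible (𝓟 := Ideal.span {π}) ⟨?_, ?_, ?_⟩ hprime hmonic.isPrimitive
    (by rw [hdeg]; exact hm)
  · rw [hmonic.leadingCoeff, Ideal.mem_span_singleton]
    exact hπ.not_dvd_one
  · intro n hn
    rw [hdeg] at hn
    rw [coeff_add, coeff_X_pow, if_neg hn.ne, zero_add, coeff_C]
    split_ifs
    · exact Ideal.mem_span_singleton.mpr hdvd
    · exact Ideal.zero_mem _
  · rw [coeff_add, coeff_X_pow, if_neg hm.ne, zero_add, coeff_C, if_pos rfl, Ideal.span_singleton_pow,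
      Ideal.mem_span_singleton]
    exact hndvd

/-- … hence prime in the UFD `K[t][s]`. [cite: Lang2002, IV §3 Thm 3.1] -/
theorem prime_fermat {m : ℕ} (hm : 0 < m) (hmK : (m : K) ≠ 0) : Prime (X ^ m + C (1 + X ^ m) : K[X][X]) :=
  (irreducible_fermat hm hmK).prime

/-- The Fermat-curve coordinate ring `B′ = K[t][s] ⧸ (s^m + 1 + t^m)` is a domain (`m > 0`, `(m : K) ≠ 0`).
[cite: Lang2002, IV §3 Thm 3.1] -/
theorem isDomain_adjoinRoot_fermat {m : ℕ} (hm : 0 < m) (hmK : (m : K) ≠ 0) :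
    IsDomain (AdjoinRoot (X ^ m + C (1 + X ^ m) : K[X][X])) :=
  AdjoinRoot.isDomain_of_prime (prime_fermat hm hmK)

/-- Hypothesis (U) of LEMMA FC (B5), module form: over the domain `B′` every non-zero scalar is `M`-regular on a torsion-free `B′`-module
(derived here; Mathlib `IsSMulRegular.of_ne_zero`). [cite: Lang2002, IV §3 Thm 3.1] -/
theorem isSMulRegular_of_ne_zero {m : ℕ} (hm : 0 < m) (hmK : (m : K) ≠ 0)
    {M : Type*} [AddCommGroup M] [Module (AdjoinRoot (X ^ m + C (1 + X ^ m) : K[X][X])) M]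
    [Module.IsTorsionFree (AdjoinRoot (X ^ m + C (1 + X ^ m) : K[X][X])) M]
    {u : AdjoinRoot (X ^ m + C (1 + X ^ m) : K[X][X])} (hu : u ≠ 0) : IsSMulRegular M u := by
  haveI := isDomain_adjoinRoot_fermat hm hmK
  exact IsSMulRegular.of_ne_zero hu

/-- Hypothesis (U), scalar form: a non-zero `u : B′` is regular on `B′` itself. [cite: Lang2002, IV §3 Thm 3.1] -/
theorem isSMulRegular_self_of_ne_zero {m : ℕ} (hm : 0 < m) (hmK : (m : K) ≠ 0)
    {u : AdjoinRoot (X ^ m + C (1 + X ^ m) : K[X][X])} (hu : u ≠ 0) :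
    IsSMulRegular (AdjoinRoot (X ^ m + C (1 + X ^ m) : K[X][X])) u := by
  haveI := isDomain_adjoinRoot_fermat hm hmK
  exact (IsRegular.of_ne_zero hu).left.isSMulRegular

/-- Dictionary: in `B′ = AdjoinRoot f`, `f = s^m + 1 + t^m`, the class of `s^k + 1 + t^k` is the power sum `1^k + t^k + s^k` of
`(λ₁, λ₂, λ₃) = (1, t, s)` — the `u_k` of LEMMA FC (B5) (plumbing; any `f`). [cite: AbramovichTemkinWlodarczyk2024, §5] -/
theorem mk_fermat_eq_powerSum (f : K[X][X]) (k : ℕ) :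
    AdjoinRoot.mk f (X ^ k + C (1 + X ^ k)) =
      (1 : AdjoinRoot f) ^ k + (AdjoinRoot.of f X) ^ k + (AdjoinRoot.root f) ^ k := by
  rw [map_add, map_pow, AdjoinRoot.mk_X, AdjoinRoot.mk_C, map_add, map_one, map_pow, one_pow]
  ring

end FermatDomain

end Literature.AlgebraicGeometry.Resolution.WeightedBlowup
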